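import Literature.NumberTheory.Automorphic.HeckeEigenvectorsRankOne
import HarnessLib

/-!
# Every finite-dimensional Hecke module is the sum of its generalized Hecke eigenspaces, indexed by Satake parameters:
# `U(3)`, `U(2)` (`σ ≠ id`), `SL₂`, locally and at the places of a number field (Cartier §IV Cor. 4.2; Rogawski §4.5)

Topic `NumberTheory/Automorphic`; namespaces `Literature.NumberTheory.Automorphic[.HermitianLattice.UnramifiedLocalConjDatum |
.SymplecticCartan | .UnitaryGroup]` (lane `lit-hodgefound`, Track 2 foundations; seat `lit-hodgefound-p11`, generation 47,
row g47-#14).  THEOREMS ONLY: no definition, no named fact, no instance, no notation.  Sequel of `HeckeEigenvectorsRankOne`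
(g47-#13: Hecke eigenvectors have Satake parameters).

## The mathematics

Let `ℋ = ℂ[T₁]` be a `ℂ`-algebra generated by one element (every `T` is a polynomial in `T₁`), `ρ : ℋ → End_ℂ(V)` a
representation and `ψ : ℋ → ℂ` a character.  The **generalized simultaneous eigenspace** of `ψ` is
`V(ψ) = ⋂_T ⋃_k ker (ρ(T) - ψ(T))^k`.  **(1)** `V(ψ) = ⋃_k ker(ρ(T₁) - ψ(T₁))^k` is the generalized eigenspace of the single
operator `ρ(T₁)` (`iInf_maxGenEigenspace_eq_of_generator`): for `T = P(T₁)`, `ρ(T) - ψ(T) = P(ρ T₁) - P(ψ T₁) = Q(ρ T₁)(ρ T₁ - ψ T₁)`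
with `Q = (P - P(ψ T₁)) / (X - ψ T₁)`, so `(ρ T - ψ T)^k = Q(ρ T₁)^k (ρ T₁ - ψ T₁)^k` kills `ker (ρ T₁ - ψ T₁)^k`.  **(2)** If `V`
is finite-dimensional then `V = Σ_μ ⋃_k ker(ρ T₁ - μ)^k` (Jordan decomposition, `ℂ` algebraically closed), and if every
`μ ∈ ℂ` is `ψ(T₁)` for some character `ψ` of a given family, then **`V = Σ_ψ V(ψ)`** over that family
(`iSup_iInf_maxGenEigenspace_eq_top_of_generator`).  **(3)** For the rank-one spherical Hecke algebras the basic Hecke operator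
`1_{K₀tK₀}` generates and takes every complex value on the unramified eigencharacters (g46 `SymplecticRankOneBasicHeckeOperator`,
`UnitaryRankOneBasicHeckeOperator`), so **every finite-dimensional Hecke module for `U(3)`, `U(2)` (`σ ≠ id`) or `SL₂` is the
sum of its generalized Hecke eigenspaces `V(λ_β)` indexed by torus parameters `β`** — locally and at the places.

## What is formalised (theorems only)

* §1 (abstract) `aeval_sub_algebraMap_eval_eq_mul`, **`iInf_maxGenEigenspace_eq_of_generator`**,
  **`iSup_iInf_maxGenEigenspace_eq_top_of_generator`**.
* §2 (`U(3)`, `U(2)`, local) **`iSup_iInf_maxGenEigenspace_heckeEigencharacter_eq_top_three/two`**.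
* §3 (`SL₂`, local and at places) **`iSup_iInf_maxGenEigenspace_symplecticHeckeEigencharacter_eq_top_rank_one`**,
  `iSup_iInf_maxGenEigenspace_symplecticHeckeEigencharacterAdic_eq_top_rank_one`.
* §4 (`U(3)`, `U(2)` at inert unramified places) `iSup_iInf_maxGenEigenspace_unitaryHeckeEigencharacterAdic_eq_top_three/two`.

## References
* [CartierCorvallis1979] P. Cartier, *Representations of 𝔭-adic groups: a survey*, PSPM 33.1 (1979), §IV Thm. 4.1, Cor. 4.2.
* [Rogawski1990] J. D. Rogawski, *Automorphic Representations of Unitary Groups in Three Variables* (1990), §4.5 p. 50.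
* [Macdonald1995] I. G. Macdonald, *Symmetric Functions and Hall Polynomials*, 2nd ed. (1995), Ch. V (3.4).
-/

noncomputable section

open scoped Valued WithZero Matrix MatrixGroups
open Matrix MonoidAlgebra Representation NumberField IsDedekindDomain Polynomial

/-! ## §1 Generalized simultaneous eigenspaces of a one-generator algebra -/

namespace Literature.NumberTheory.Automorphic

/-- `P(f) - P(μ)·1 = Q(f) ∘ (f - μ·1)` with `Q = (P - P(μ)) / (X - μ)`, for an endomorphism `f`. [cite: CartierCorvallis1979, §IV Cor. 4.2] -/
theorem aeval_sub_algebraMap_eval_eq_mul {V : Type*} [AddCommGroup V] [Module ℂ V] (f : Module.End ℂ V) (P : ℂ[X]) (μ : ℂ) :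
    aeval f P - algebraMap ℂ (Module.End ℂ V) (P.eval μ) =
      aeval f ((P - C (P.eval μ)) /ₘ (X - C μ)) * (f - μ • (1 : Module.End ℂ V)) := by
  have hroot : IsRoot (P - C (P.eval μ)) μ := by rw [IsRoot.def, eval_sub, eval_C, sub_self]
  have h := mul_divByMonic_eq_iff_isRoot.2 hroot
  calc aeval f P - algebraMap ℂ (Module.End ℂ V) (P.eval μ) = aeval f (P - C (P.eval μ)) := by rw [map_sub, aeval_C]
    _ = aeval f ((P - C (P.eval μ)) /ₘ (X - C μ) * (X - C μ)) := by rw [mul_comm, h]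
    _ = aeval f ((P - C (P.eval μ)) /ₘ (X - C μ)) * (f - μ • (1 : Module.End ℂ V)) := by
      rw [map_mul, map_sub, aeval_X, aeval_C, Algebra.algebraMap_eq_smul_one]

/-- **The generalized simultaneous eigenspace of a character `ψ` of a one-generator algebra `ℂ[T₁]` is the generalized
eigenspace of `ρ(T₁)` for `ψ(T₁)`**: `⋂_T ⋃_k ker(ρ T - ψ T)^k = ⋃_k ker(ρ T₁ - ψ T₁)^k`. [cite: CartierCorvallis1979, §IV Cor. 4.2] -/
theorem iInf_maxGenEigenspace_eq_of_generator {A V : Type*} [Semiring A] [Algebra ℂ A] [AddCommGroup V] [Module ℂ V]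
    (ρ : A →ₐ[ℂ] Module.End ℂ V) (ψ : A →ₐ[ℂ] ℂ) {T₁ : A} (hgen : ∀ T, ∃ P : ℂ[X], aeval T₁ P = T) :
    (⨅ T, (ρ T).maxGenEigenspace (ψ T)) = (ρ T₁).maxGenEigenspace (ψ T₁) := by
  refine le_antisymm (iInf_le _ T₁) (le_iInf fun T => fun v hv => ?_)
  rw [Module.End.mem_maxGenEigenspace] at hv ⊢
  obtain ⟨k, hk⟩ := hv
  obtain ⟨P, rfl⟩ := hgen T
  refine ⟨k, ?_⟩
  have hψ : ψ (aeval T₁ P) = P.eval (ψ T₁) := by rw [← aeval_algHom_apply, coe_aeval_eq_eval]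
  have h1 : ρ T₁ - ψ T₁ • (1 : Module.End ℂ V) = aeval (ρ T₁) (X - C (ψ T₁)) := by
    rw [map_sub, aeval_X, aeval_C, Algebra.algebraMap_eq_smul_one]
  have hc : Commute (aeval (ρ T₁) ((P - C (P.eval (ψ T₁))) /ₘ (X - C (ψ T₁)))) (ρ T₁ - ψ T₁ • (1 : Module.End ℂ V)) := by
    change _ * _ = _ * _
    rw [h1, ← map_mul, ← map_mul, mul_comm]
  rw [hψ, ← aeval_algHom_apply, ← Algebra.algebraMap_eq_smul_one, aeval_sub_algebraMap_eval_eq_mul, hc.mul_pow,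
    Module.End.mul_apply, hk, map_zero]

/-- **`V = Σ_ψ V(ψ)`**: a finite-dimensional module over a one-generator algebra `ℂ[T₁]` is the sum of the generalized
simultaneous eigenspaces `V(ψ) = ⋂_T ⋃_k ker(ρ T - ψ T)^k` over any family of characters `ψ_i` whose values `ψ_i(T₁)` exhaust `ℂ`.
[cite: CartierCorvallis1979, §IV Cor. 4.2] -/
theorem iSup_iInf_maxGenEigenspace_eq_top_of_generator {A V ι : Type*} [Semiring A] [Algebra ℂ A] [AddCommGroup V] [Module ℂ V]
    [FiniteDimensional ℂ V] (ρ : A →ₐ[ℂ] Module.End ℂ V) {T₁ : A} (hgen : ∀ T, ∃ P : ℂ[X], aeval T₁ P = T)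
    (ψ : ι → (A →ₐ[ℂ] ℂ)) (hsurj : ∀ μ : ℂ, ∃ i, ψ i T₁ = μ) :
    (⨆ i, ⨅ T, (ρ T).maxGenEigenspace (ψ i T)) = ⊤ := by
  refine top_le_iff.1 ((Module.End.iSup_maxGenEigenspace_eq_top (ρ T₁)).symm.le.trans (iSup_le fun μ => ?_))
  obtain ⟨i, hi⟩ := hsurj μ
  rw [← hi, ← iInf_maxGenEigenspace_eq_of_generator ρ (ψ i) hgen]
  exact le_iSup (fun i => ⨅ T, (ρ T).maxGenEigenspace (ψ i T)) i

end Literature.NumberTheory.Automorphic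

/-! ## §2 `U(3)` and `U(2)` (`σ ≠ id`) -/

namespace Literature.NumberTheory.Automorphic.HermitianLattice.UnramifiedLocalConjDatum

open Literature.NumberTheory.Automorphic.CartanUnique Literature.NumberTheory.Automorphic.SymplecticCartan
  Literature.NumberTheory.Automorphic

variable {K : Type*} [Field K] [Valued K ℤᵐ⁰] {σ : K →+* K} {ϖ : K} [Finite 𝓀[K]]
  {V : Type*} [AddCommGroup V] [Module ℂ V] [FiniteDimensional ℂ V]

/-- **EVERY FINITE-DIMENSIONAL `ℋ(U(3), K₀; ℂ)`-MODULE IS THE SUM OF ITS GENERALIZED HECKE EIGENSPACES `V(λ_β)`**, indexed by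
torus parameters `β ∈ (ℂˣ)³` (`σ ≠ id`): `Σ_β ⋂_T ⋃_k ker(ρ T - λ_β(T))^k = V`. [cite: CartierCorvallis1979, §IV Thm. 4.1, Cor. 4.2]
[cite: Rogawski1990, §4.5 p. 50] -/
theorem iSup_iInf_maxGenEigenspace_heckeEigencharacter_eq_top_three
    [IsHeckeTriple (⊤ : Submonoid (unitaryGroupOfForm σ ((StdForm.antidiagonal 3).over K)))
      (unitaryInt σ ((StdForm.antidiagonal 3).over K)) (unitaryInt σ ((StdForm.antidiagonal 3).over K))]
    (hd : UnramifiedLocalConjDatum σ ϖ) (hσ : ∃ x : K, σ x ≠ x)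
    (ρ : heckeAlgebra ℂ (unitaryGroupOfForm σ ((StdForm.antidiagonal 3).over K)) (unitaryInt σ ((StdForm.antidiagonal 3).over K)) →ₐ[ℂ]
      Module.End ℂ V) :
    (⨆ β : Fin 3 → ℂˣ, ⨅ T, (ρ T).maxGenEigenspace (hd.heckeEigencharacter β T)) = ⊤ :=
  iSup_iInf_maxGenEigenspace_eq_top_of_generator ρ (hd.exists_aeval_doubleCosetOperator_basic_three hσ)
    (fun β => hd.heckeEigencharacter β) (hd.exists_heckeEigencharacter_doubleCosetOperator_eq_three hσ)

/-- **Every finite-dimensional `ℋ(U(2), K₀; ℂ)`-module is the sum of its generalized Hecke eigenspaces `V(λ_β)`** (`σ ≠ id`).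
[cite: CartierCorvallis1979, §IV Thm. 4.1, Cor. 4.2] [cite: Rogawski1990, §4.5 p. 50] -/
theorem iSup_iInf_maxGenEigenspace_heckeEigencharacter_eq_top_two
    [IsHeckeTriple (⊤ : Submonoid (unitaryGroupOfForm σ ((StdForm.antidiagonal 2).over K)))
      (unitaryInt σ ((StdForm.antidiagonal 2).over K)) (unitaryInt σ ((StdForm.antidiagonal 2).over K))]
    (hd : UnramifiedLocalConjDatum σ ϖ) (hσ : ∃ x : K, σ x ≠ x)
    (ρ : heckeAlgebra ℂ (unitaryGroupOfForm σ ((StdForm.antidiagonal 2).over K)) (unitaryInt σ ((StdForm.antidiagonal 2).over K)) →ₐ[ℂ]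
      Module.End ℂ V) :
    (⨆ β : Fin 2 → ℂˣ, ⨅ T, (ρ T).maxGenEigenspace (hd.heckeEigencharacter β T)) = ⊤ :=
  iSup_iInf_maxGenEigenspace_eq_top_of_generator ρ (hd.exists_aeval_doubleCosetOperator_basic_two hσ)
    (fun β => hd.heckeEigencharacter β) (hd.exists_heckeEigencharacter_doubleCosetOperator_eq_two hσ)

end Literature.NumberTheory.Automorphic.HermitianLattice.UnramifiedLocalConjDatum

/-! ## §3 `SL₂(K)` and `SL₂(F_v)` -/

namespace Literature.NumberTheory.Automorphic.SymplecticCartan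

open Literature.NumberTheory.Automorphic.CartanUnique Literature.NumberTheory.Automorphic

section Local

variable {K : Type*} [Field K] [Valued K ℤᵐ⁰] {ϖ : K} (hϖ : Valued.v ϖ = WithZero.exp (-1 : ℤ)) [Finite 𝓀[K]]
  [IsHeckeTriple (⊤ : Submonoid (symplecticGroup (Fin 1) K)) (symplecticInt (Fin 1) K) (symplecticInt (Fin 1) K)]
  {V : Type*} [AddCommGroup V] [Module ℂ V] [FiniteDimensional ℂ V]
include hϖ

/-- **`λ_{χ_z}(1_{K₀tK₀})` takes every complex value** (`z ∈ ℂˣ` a root of `q z² + (q - 1 - c₀) z + q`).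
[cite: CartierCorvallis1979, §IV (4.2), Cor. 4.2] -/
theorem exists_symplecticHeckeEigencharacter_laurent_basic_eq_rank_one (q : ℂˣ) (hq : (q : ℂ) = Nat.card 𝓀[K]) (c₀ : ℂ) :
    ∃ z : ℂˣ, symplecticHeckeEigencharacter hϖ q (laurentMonomialHom fun _ : Fin 1 => z)
        (heckeAlgebra.doubleCosetOperator (symplecticInt (Fin 1) K)
          (⟨Matrix.diagonal (Sum.elim (fun _ : Fin 1 => ϖ ^ (1 : ℕ)) (fun _ : Fin 1 => (ϖ ^ (1 : ℕ))⁻¹)),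
            diagonal_pow_mem_symplecticGroup (uniformizer_ne_zero hϖ) (fun _ : Fin 1 => 1)⟩ : symplecticGroup (Fin 1) K)) = c₀ := by
  obtain ⟨z, hz0, hz⟩ := exists_root_quadratic_symm (Units.ne_zero q) ((q : ℂ) - 1 - c₀)
  refine ⟨Units.mk0 z hz0, ?_⟩
  rw [symplecticHeckeEigencharacter_doubleCosetOperator_basic hϖ q hq, laurentMonomialHom_const_ofAdd_rank_one,
    laurentMonomialHom_const_ofAdd_rank_one, zpow_one, _root_.zpow_neg, zpow_one, Units.val_inv_eq_inv_val, Units.val_mk0]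
  field_simp
  linear_combination hz

/-- **EVERY FINITE-DIMENSIONAL `ℋ(SL₂(K), SL₂(𝒪); ℂ)`-MODULE IS THE SUM OF ITS GENERALIZED HECKE EIGENSPACES `V(λ_{χ_z})`**,
`z ∈ ℂˣ` (`q ∈ ℂˣ` the residue cardinality). [cite: CartierCorvallis1979, §IV Thm. 4.1, Cor. 4.2] [cite: Macdonald1995, Ch. V (3.4)] -/
theorem iSup_iInf_maxGenEigenspace_symplecticHeckeEigencharacter_eq_top_rank_one (q : ℂˣ) (hq : (q : ℂ) = Nat.card 𝓀[K])
    (ρ : heckeAlgebra ℂ (symplecticGroup (Fin 1) K) (symplecticInt (Fin 1) K) →ₐ[ℂ] Module.End ℂ V) :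
    (⨆ z : ℂˣ, ⨅ T, (ρ T).maxGenEigenspace (symplecticHeckeEigencharacter hϖ q (laurentMonomialHom fun _ : Fin 1 => z) T)) = ⊤ :=
  iSup_iInf_maxGenEigenspace_eq_top_of_generator ρ (exists_aeval_doubleCosetOperator_basic_symplectic hϖ q hq)
    (fun z => symplecticHeckeEigencharacter hϖ q (laurentMonomialHom fun _ : Fin 1 => z))
    (exists_symplecticHeckeEigencharacter_laurent_basic_eq_rank_one hϖ q hq)

end Local

section NumberField

variable (F : Type*) [Field F] [NumberField F] (v : HeightOneSpectrum (𝓞 F)) {V : Type*} [AddCommGroup V] [Module ℂ V]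
  [FiniteDimensional ℂ V]

/-- **At every finite place `v`: every finite-dimensional `ℋ(SL₂(F_v), SL₂(𝒪_v); ℂ)`-module is the sum of its generalized Hecke
eigenspaces `V(λ_{v,χ_z})`, `z ∈ ℂˣ`.** [cite: CartierCorvallis1979, §IV Thm. 4.1, Cor. 4.2] -/
theorem iSup_iInf_maxGenEigenspace_symplecticHeckeEigencharacterAdic_eq_top_rank_one
    (ρ : heckeAlgebra ℂ (symplecticGroup (Fin 1) (v.adicCompletion F)) (symplecticInt (Fin 1) (v.adicCompletion F)) →ₐ[ℂ]
      Module.End ℂ V) :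
    (⨆ z : ℂˣ, ⨅ T, (ρ T).maxGenEigenspace (symplecticHeckeEigencharacterAdic F v (laurentMonomialHom fun _ : Fin 1 => z) T)) = ⊤ := by
  haveI := finite_residueField_adicCompletion F v
  haveI := isHeckeTriple_symplecticInt_adicCompletion F v (l := Fin 1)
  exact iSup_iInf_maxGenEigenspace_symplecticHeckeEigencharacter_eq_top_rank_one (v_adicUniformizer F v) (residueNormUnit F v)
    (coe_residueNormUnit_eq_natCard F v) ρ

end NumberField

end Literature.NumberTheory.Automorphic.SymplecticCartan

/-! ## §4 `U(3)(E_w)`, `U(2)(E_w)` at the inert unramified places of a quadratic extension of number fields -/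

namespace Literature.NumberTheory.Automorphic.UnitaryGroup

open Literature.NumberTheory.Automorphic.HermitianLattice Literature.NumberTheory.Automorphic

variable {F E : Type} [Field F] [NumberField F] [Field E] [NumberField E] [Algebra F E] [Algebra.IsQuadraticExtension F E]
  (c : E ≃ₐ[F] E) (hc1 : c ≠ 1) (v : HeightOneSpectrum (𝓞 F)) (w : PlacesOver E v) (hw : c • w.1 = w.1)
  (hv : Algebra.IsUnramifiedIn (𝓞 E) v.asIdeal) {V : Type*} [AddCommGroup V] [Module ℂ V] [FiniteDimensional ℂ V]

/-- **At every inert unramified place: every finite-dimensional `ℋ(U(3)(E_w), K₀; ℂ)`-module is the sum of its generalized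
Hecke eigenspaces `V(λ_{w,β})`, `β ∈ (ℂˣ)³`.** [cite: CartierCorvallis1979, §IV Thm. 4.1, Cor. 4.2] [cite: Rogawski1990, §4.5 p. 50] -/
theorem iSup_iInf_maxGenEigenspace_unitaryHeckeEigencharacterAdic_eq_top_three
    (ρ : heckeAlgebra ℂ (unitaryGroupOfForm (galAdicCompletionMap (L := E) c hw) ((StdForm.antidiagonal 3).over (w.1.adicCompletion E)))
      (unitaryInt (galAdicCompletionMap (L := E) c hw) ((StdForm.antidiagonal 3).over (w.1.adicCompletion E))) →ₐ[ℂ] Module.End ℂ V) :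
    (⨆ β : Fin 3 → ℂˣ, ⨅ T, (ρ T).maxGenEigenspace (unitaryHeckeEigencharacterAdic c hc1 v w hw hv β T)) = ⊤ := by
  haveI := finite_residueField_adicCompletion E w.1
  haveI := isHeckeTriple_unitaryInt_adicCompletion c v w hw ((StdForm.antidiagonal 3).over (w.1.adicCompletion E))
  have h := (unramifiedLocalConjDatum_localConjUniformizer c hc1 v w hw hv).iSup_iInf_maxGenEigenspace_heckeEigencharacter_eq_top_three
    (exists_galAdicCompletionMap_ne c hc1 v w hw) ρ
  simp only [← unitaryHeckeEigencharacterAdic_eq c hc1 v w hw hv (unramifiedLocalConjDatum_localConjUniformizer c hc1 v w hw hv)] at h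
  exact h

/-- **At every inert unramified place: every finite-dimensional `ℋ(U(2)(E_w), K₀; ℂ)`-module is the sum of its generalized
Hecke eigenspaces `V(λ_{w,β})`, `β ∈ (ℂˣ)²`.** [cite: CartierCorvallis1979, §IV Thm. 4.1, Cor. 4.2] [cite: Rogawski1990, §4.5 p. 50] -/
theorem iSup_iInf_maxGenEigenspace_unitaryHeckeEigencharacterAdic_eq_top_two
    (ρ : heckeAlgebra ℂ (unitaryGroupOfForm (galAdicCompletionMap (L := E) c hw) ((StdForm.antidiagonal 2).over (w.1.adicCompletion E)))
      (unitaryInt (galAdicCompletionMap (L := E) c hw) ((StdForm.antidiagonal 2).over (w.1.adicCompletion E))) →ₐ[ℂ] Module.End ℂ V) :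
    (⨆ β : Fin 2 → ℂˣ, ⨅ T, (ρ T).maxGenEigenspace (unitaryHeckeEigencharacterAdic c hc1 v w hw hv β T)) = ⊤ := by
  haveI := finite_residueField_adicCompletion E w.1
  haveI := isHeckeTriple_unitaryInt_adicCompletion c v w hw ((StdForm.antidiagonal 2).over (w.1.adicCompletion E))
  have h := (unramifiedLocalConjDatum_localConjUniformizer c hc1 v w hw hv).iSup_iInf_maxGenEigenspace_heckeEigencharacter_eq_top_two
    (exists_galAdicCompletionMap_ne c hc1 v w hw) ρ
  simp only [← unitaryHeckeEigencharacterAdic_eq c hc1 v w hw hv (unramifiedLocalConjDatum_localConjUniformizer c hc1 v w hw hv)] at h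
  exact h

end Literature.NumberTheory.Automorphic.UnitaryGroup
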